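import Summits.HubbardSuperconductivity.HubbardSuperconductivity.Theses.PlaquetteBoson
import Summits.HubbardSuperconductivity.HubbardSuperconductivity.Theorems.TwTipContinuation.Negative.TipNormalForm
import HarnessLib

/-!
# Crux `PbContinuation` (stmt-HubbardSuperconductivity-0907; route `PlaquetteBoson` rank 5 "the bet",
shared by routes `AnisotropyChord`, `LevyLogBootstrap`, `PolyaSchurPairBoson`) — BIRTH SKELETON
`Lines/birth.lean` (BC3)

THE CRUX (fixed; `Theses/PlaquetteBoson.lean`, decl `PbContinuation`, not restated here): for ALL
`U > 0`, `δ ∈ (0,1/2)` — IF the checkerboard Hubbard tori `H_L(t',U) = hamiltonian G_intra 1 U +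
hamiltonian G_inter t' 0` (2×2 plaquettes with hopping `1` and on-site `U`, glued by hopping `t'`;
`G_intra = fermionTorusGraph 2 L ∖ comap label ⊤`, `G_inter = fermionTorusGraph 2 L ⊓ comap label ⊤`,
`label x = (⌊x₀/2⌋, ⌊x₁/2⌋)`) have, for every small `t' ∈ (0,t₀)`, EVERY-ground-state `d_{x²-y²}`
pair-field order `c(t') L⁴ ≤ Re⟨ψ, Δ_d†Δ_d ψ⟩` in the `(N_L = 2⌊(1-δ)L²/2⌋, S^z = 0)` sector on all
large tori with `4 ∣ L` (the ANCHOR shape of `PbAnchorOrder`), THEN the summit's matrix holds at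
`(U,δ)`: every admissible sequence of normalised sector ground states of the UNIFORM model
`hubbardTorus 2 L 1 U` (`= H_L(1,U)`) has `HasLongRangeOrder` of
`torusPullback (pairFieldCorr dWaveFormFactor ψ)` along the even sides `2k`.

THE LINE = the crux's own stated content ("no quantum phase transition in `t'` at fixed `(U,δ)`, plus
removal of the `L ≡ 0 mod 4` artefact at the uniform point, plus the pointwise-to-liminf
bookkeeping"), cut at its two natural joints; the third piece is ALREADY A TREE THEOREM and is used
by name, not stubbed:

1. `stub_noTransition` — THE BET (continuation `t' → 1` on the anchor's own tori `L ∈ 4ℕ`): under the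
   anchor hypothesis at `(U,δ)`, the uniform model `hubbardTorus 2 L 1 U` — the endpoint `t' = 1` of
   the checkerboard family, `H_L(1,U) = hamiltonian (G ∖ K) 1 U + hamiltonian (G ⊓ K) 1 0 =
   hamiltonian G 1 U` (the two edge sets partition the torus bonds; the `U`-term sits in the first
   summand only) — has an eventual, uniform, EVERY-ground-state bound `c L⁴ ≤ Re⟨ψ, Δ_d†Δ_d ψ⟩` on
   the tori with `4 ∣ L`. Content: absence of a ground-state phase transition along the
   inter-plaquette coupling `t' ∈ (0,1]` at fixed `(U,δ)` (DCA evidence: d-wave order survives and is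
   maximal at `t' = 1`, Doluweera et al. 2008; Chakraborty–Sénéchal–Tremblay 2011), to be obtained by
   a model-specific mechanism (the crux's handles: Rellich/Kato continuation of the `B1g` pair
   susceptibility under a twist-gap lower bound; numerics first). Leans on (landed, by name): the
   endpoint identity `H_L(1,U) = hubbardTorus 2 L 1 U` is `Literature…hamiltonian_sdiff_add_inf` /
   route item `CooperPairDMottWalk.BreathingAtOneIsPure` (proved, stmt-HubbardSuperconductivity-1179),
   and the uniform point is the SELF-DUAL point of the breathing family `H_L(a,b,U) ≅ H_L(b,a,U)`
   (`Literature…breathingSelfDual_of_four_le`, even `L ≥ 4`), so the path may equivalently be run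
   from either side. Why it might fail: the crux's own
   why-might-fail — typed over ALL `(U,δ)`, physically false wherever small-`t'` plaquette-pair order
   coexists with a non-`d_{x²-y²}` uniform ground state (`δ > 0.4` `d_xy`/`p`, Deng et al. 2015;
   `δ → 0⁺` AF; stripes at `U ≈ 4–8`, Qin et al. 2020; 1st-order d-CDW/PS near `U_s ≈ 2.7`, Yao–
   Tsai–Kivelson 2007) — there a proof must REFUTE the anchor premise instead. The MODEL-FREE shape
   "lit at small coupling ⇒ lit at the endpoint" is false by level crossing (sibling crux
   `TwTipContinuation`, `Theorems/TwTipContinuation/Negative/AbstractTipShapeFalse.lean: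
   not_abstractTipShape`), so the stub is typed on the Hubbard family and any proof must use its
   structure. Size: crux-sized (the residual of the crux).
2. `stub_evenSides` — REMOVAL OF THE `mod 4` ARTEFACT at the uniform point: an eventual uniform
   every-GS order bound for `hubbardTorus 2 L 1 U` along `L ∈ 4ℕ` gives one (possibly with a smaller
   constant and a later threshold) along ALL even `L`. At `t' = 1` no plaquette structure remains, so
   physically both sides say "the infinite-volume ground state at `(U,δ)` has `d`-wave LRO"; but the
   summit's `liminf` runs over EVERY even side, and the finite-size spectra of a nodal `d`-wave state
   DO depend on `L mod 4` (the momentum grid `(2π/L)ℤ²` meets the zone-diagonal nodal region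
   differently; card `nodes-meet-the-grid`, Paramekanti–Randeria–Trivedi cond-mat/0305611), so this is
   a genuine thermodynamic-limit statement (tools: comparison of tori of different sides / uniqueness
   of the infinite-volume limit; none in tree). Why it might fail: an `L ≡ 2 (mod 4)` anomaly of the
   every-GS bound surviving to `L → ∞` (no known mechanism at `δ > 0`; irrefutable by ED beyond
   `L = 6`). Size: M–L.
3. (NOT A STUB — landed) `Summit.HubbardSuperconductivity.TwTipContinuation.Negative.summitMatrix_of_everyGSOrder`
   (`Theorems/TwTipContinuation/Negative/TipNormalForm.lean`): an eventual uniform every-GS bound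
   along even `L` gives the summit's matrix at `(U,δ)` (sum rule `Re⟨Δ_d†Δ_d⟩ = Σ_{x,y} pairFieldCorr`,
   `torusPullback` over `halfOpenBox 2 (2k)`, a-priori cap `expect_pairIntensity_le` making the real
   `liminf` honest). Its converse `everyGSOrder_of_summitMatrix` is also landed, so piece 2's
   conclusion is EQUIVALENT to the crux's conclusion at `(U,δ)` — the cut loses nothing.

COMPOSITION `PbContinuation_of : PbContinuation` (harness skeleton convention A12: concludes the crux
BY NAME, no hypotheses, cites the declared stubs by name; no `sorry` outside the stubs): for
`U, δ, hU, hδ` and the anchor hypothesis `hA`, `summitMatrix_of_everyGSOrder (stub_evenSides U δ hU hδ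
(stub_noTransition U δ hU hδ hA))`. Read with the stubs abstracted this is the pure-logic implication
`stub_noTransition-sig → stub_evenSides-sig → PbContinuation`.

DISPROOF USED: no `Cruxes/PbContinuation/Disproof.lean` and no `Theorems/PbContinuation/Negative/`
exist (2026-08-17; `ledger crux ls stmt-HubbardSuperconductivity-0907`: no workfiles). Honoured from the
sibling continuation crux `TwTipContinuation`: `not_abstractTipShape` / `UniformRungsShapeFalse` (the
abstract continuation shape is false ⇒ stub 1 is model-typed). `ledger negatives --problem
HubbardSuperconductivity` (2026-08-17, 2 entries: stmt-1180 `BreathingSelfDual` — the `L = 2` artefact of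
the breathing family, class misstated, repaired as `4 ≤ L`; stmt-1314 `KlsOrderOpenness`): neither stub
is an instance (both stubs are eventual-in-`L` statements about `hubbardTorus`).

BC3 AUDIT (planner folder `bc/`, farm `lean check --json`): this file rc 0, `sorries = 2` = the two
stubs (warnings only `declaration uses sorry` at `stub_noTransition`, `stub_evenSides`; zero elsewhere;
file audit: `PbContinuation_of` proof-of-item for `PlaquetteBoson.PbContinuation`, not closed: axioms
[sorryAx]). PROBES, one `example` per tactic alternative with `maxHeartbeats 400000`, hypothesis = the
stub signature verbatim, this file NOT imported: `stub_noTransition → PbContinuation`,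
`stub_noTransition → HubbardSuperconductivity`, `stub_evenSides → PbContinuation`,
`stub_evenSides → HubbardSuperconductivity`, each by `exact?` ("could not close the goal"), `simpa`,
`simpa [target]`, `unfold target; simpa` ("assumption failed"), `aesop`, `intro; unfold; aesop`
("unsolved goals ⊢ PbContinuation" / "⊢ HubbardSuperconductivity"; one heartbeat timeout) — 24/24 FAIL;
positive controls `stub → stub` rc 0. No stub is cheaply the crux or the summit.

Sources: Doluweera–et-al PRB 78 (2008) 020504 (doi:10.1103/physrevb.78.020504); Chakraborty–Sénéchal–
Tremblay PRB 84 (2011) 054545; Yao–Tsai–Kivelson PRB 76 (2007) 161104; Deng–Kozik–Prokof'ev–Svistunov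
EPL 110 (2015) 57001 (arXiv:1408.2088); Qin et al. PRX 10 (2020) 031016; Paramekanti–Randeria–Trivedi
PRB 70 (2004) 054504 (cond-mat/0305611); D. J. Scalapino, Phys. Rep. 250 (1995) 329, §2 (the order
functional); T. Kato, Perturbation Theory for Linear Operators (1966) II §6 / VII §3 (analytic
continuation of isolated eigenvalues — the intended tool of stub 1). No definition is introduced; all
statements are over existing declarations.
-/

noncomputable section

-- `dupNamespace`: the summit and the problem are both named `HubbardSuperconductivity` (layout D-0022)
set_option linter.dupNamespace false

namespace Summit.HubbardSuperconductivity.HubbardSuperconductivity.Cruxes.PbContinuation.Birth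

open Matrix Filter
open Literature.Probability.LatticeModels Literature.MathematicalPhysics.QuantumLattice
open Summit.HubbardSuperconductivity.HubbardSuperconductivity.Theses.PlaquetteBoson (PbContinuation)
open Summit.HubbardSuperconductivity.TwTipContinuation.Negative (summitMatrix_of_everyGSOrder)

/-! ## The two stubs -/

/-- **STUB 1 `stub_noTransition` — THE BET** (no ground-state phase transition along the
inter-plaquette coupling `t' ∈ (0,1]` at fixed `(U,δ)`, on the anchor's tori `L ∈ 4ℕ`). For every
`U > 0` and `δ ∈ (0,1/2)`: if the checkerboard family `H_L(t',U)` has every-ground-state `d_{x²-y²}`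
pair-field order `c(t') L⁴ ≤ Re⟨ψ, Δ_d†Δ_d ψ⟩` in the `(2⌊(1-δ)L²/2⌋, S^z = 0)` sector for all small
`t'` and all large `L` with `4 ∣ L` (the anchor hypothesis of the crux, verbatim), then so does the
uniform model `hubbardTorus 2 L 1 U = H_L(1,U)` along `L ∈ 4ℕ`. Not claimed provable now: this is the
residual of the crux; its model-free shape is false (`not_abstractTipShape`), and over ALL `(U,δ)` it
can only hold where the anchor premise fails outside the `d_{x²-y²}` dome (Deng et al. 2015, Qin et al.
2020). Doluweera et al., PRB 78 (2008) 020504; Kato (1966) VII §3. -/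
theorem stub_noTransition :
    ∀ (U δ : ℝ), 0 < U → δ ∈ Set.Ioo (0:ℝ) (1/2) →
      (∃ t₀ : ℝ, 0 < t₀ ∧ ∀ t' ∈ Set.Ioo (0:ℝ) t₀, ∃ c : ℝ, 0 < c ∧ ∃ L₀ : ℕ, ∀ (L : ℕ) [NeZero L],
        L₀ ≤ L → 4 ∣ L → ∀ (N : ℕ) (ψ : Fock (Orb (FermionTorus 2 L))),
          N = 2 * ⌊(1 - δ) * (L : ℝ) ^ 2 / 2⌋₊ → star ψ ⬝ᵥ ψ = 1 →
          IsGroundStateInSector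
            (hamiltonian ((fermionTorusGraph 2 L) \ SimpleGraph.comap
                (fun x : FermionTorus 2 L => fun i : Fin 2 => ((ofLex x) i : ℕ) / 2) ⊤) 1 U +
              hamiltonian ((fermionTorusGraph 2 L) ⊓ SimpleGraph.comap
                (fun x : FermionTorus 2 L => fun i : Fin 2 => ((ofLex x) i : ℕ) / 2) ⊤) t' 0) N 0 ψ →
          c * (L : ℝ) ^ 4 ≤
            (expect ((pairField dWaveFormFactor L)ᴴ * pairField dWaveFormFactor L) ψ).re) →
      ∃ c : ℝ, 0 < c ∧ ∃ L₀ : ℕ, ∀ (L : ℕ) [NeZero L], L₀ ≤ L → 4 ∣ L →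
        ∀ ψ : Fock (Orb (FermionTorus 2 L)), star ψ ⬝ᵥ ψ = 1 →
          IsGroundStateInSector (hubbardTorus 2 L 1 U) (2 * ⌊(1 - δ) * (L : ℝ) ^ 2 / 2⌋₊) 0 ψ →
            c * (L : ℝ) ^ 4 ≤
              (expect ((pairField dWaveFormFactor L)ᴴ * pairField dWaveFormFactor L) ψ).re := by
  sorry

/-- **STUB 2 `stub_evenSides` — REMOVAL OF THE `L ≡ 0 (mod 4)` ARTEFACT AT THE UNIFORM POINT.**
For every `U > 0` and `δ ∈ (0,1/2)`: an eventual, uniform, every-ground-state `d_{x²-y²}` pair-field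
bound `c L⁴ ≤ Re⟨ψ, Δ_d†Δ_d ψ⟩` for the uniform model `hubbardTorus 2 L 1 U` in the
`(2⌊(1-δ)L²/2⌋, S^z = 0)` sector along the sides `L ∈ 4ℕ` implies one (new constant, new threshold)
along ALL even sides — the summit's `liminf` runs over every even side. A thermodynamic-limit
statement (the finite-size spectrum of a nodal `d`-wave state depends on `L mod 4` through the
momentum grid; Paramekanti–Randeria–Trivedi, PRB 70 (2004) 054504), not bookkeeping; no tool in tree.
Scalapino, Phys. Rep. 250 (1995) 329, §2 (the order functional). -/
theorem stub_evenSides :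
    ∀ (U δ : ℝ), 0 < U → δ ∈ Set.Ioo (0:ℝ) (1/2) →
      (∃ c : ℝ, 0 < c ∧ ∃ L₀ : ℕ, ∀ (L : ℕ) [NeZero L], L₀ ≤ L → 4 ∣ L →
        ∀ ψ : Fock (Orb (FermionTorus 2 L)), star ψ ⬝ᵥ ψ = 1 →
          IsGroundStateInSector (hubbardTorus 2 L 1 U) (2 * ⌊(1 - δ) * (L : ℝ) ^ 2 / 2⌋₊) 0 ψ →
            c * (L : ℝ) ^ 4 ≤
              (expect ((pairField dWaveFormFactor L)ᴴ * pairField dWaveFormFactor L) ψ).re) →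
      ∃ c : ℝ, 0 < c ∧ ∃ L₀ : ℕ, ∀ (L : ℕ) [NeZero L], L₀ ≤ L → Even L →
        ∀ ψ : Fock (Orb (FermionTorus 2 L)), star ψ ⬝ᵥ ψ = 1 →
          IsGroundStateInSector (hubbardTorus 2 L 1 U) (2 * ⌊(1 - δ) * (L : ℝ) ^ 2 / 2⌋₊) 0 ψ →
            c * (L : ℝ) ^ 4 ≤
              (expect ((pairField dWaveFormFactor L)ᴴ * pairField dWaveFormFactor L) ψ).re := by
  sorry

/-! ## The composition: the stubs and the landed bookkeeping theorem prove the crux BY NAME -/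

/-- **`PbContinuation` from the two stubs** (A12 skeleton: concludes the route decl
`PlaquetteBoson.PbContinuation` by name; the only `sorry`s are inside `stub_noTransition` and
`stub_evenSides`). At `(U,δ)` with anchor hypothesis `hA`: stub 1 gives the every-GS order bound of the
uniform torus along `4 ∣ L`, stub 2 upgrades it to all even `L`, and the landed
`summitMatrix_of_everyGSOrder` (sum rule + a-priori cap + honest `liminf`) turns that into the
summit's `HasLongRangeOrder` conclusion for every admissible ground-state sequence. [folklore] -/
theorem PbContinuation_of : PbContinuation := by
  intro U δ hU hδ hA
  exact summitMatrix_of_everyGSOrder (stub_evenSides U δ hU hδ (stub_noTransition U δ hU hδ hA))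

end Summit.HubbardSuperconductivity.HubbardSuperconductivity.Cruxes.PbContinuation.Birth

end
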